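import Mathlib
import HarnessLib
import HarnessLib.Audit
import Summits.CriticalPhenomena.PercolationContinuityZ3.Theorems.PercNearOneGluingNoHeavyLowerTailHexMS

/-!
# HEX-MS: the coordinate-projection reduction (hp-7 gen 65)

Support file for crux `stmt-CriticalPhenomena-4575` (`NoHeavyLowerTail`, route `PercNearOneGluingNoHeavy`), hull-port seat `prim-hp-7`
(generation 65); `--supports stmt-CriticalPhenomena-4575`.  No `sorry`.  Memo: `run/shared/lean/prim/prim-hp-7/FROM-prim-hp-7-g65-REDUCTIONS.md`.

We work with HEX-MS relative to an explicit finite ground set `U` (`HexMSRel U`; for `U = univ` this is `GeneratedDonors.HexMSAt`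
of the g64 file).  The new content is the **projection identity and reduction** (memo §0(1), §2): for a coordinate `r ∈ U`,

* `#(gen 𝒟 x) = #((gen 𝒟 x).image (erase r)) + #{p ∈ gen 𝒟 x : r ∉ p ∧ insert r p ∈ gen 𝒟 x}` (the second term counts the cube edges
  of the generated family in direction `r`), and
* for every subfamily `ℰ₀` of `r`-free members of `𝒟` containing no two sets complementary inside `U.erase r`, the family
  `ℰ₀ ∪ {(U.erase r) \ e : e ∈ ℰ₀}` with labels `x` resp. `x + 3` is an antipodal instance on the smaller ground set `U.erase r` whose
  generated family lies inside `(gen 𝒟 x).image (erase r)`.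

Consequently (`card_le_two_mul_card_gen_of_reduction`): HEX-MS for the reduced instance together with the counting hypothesis
`#𝒟 ≤ 2 #ℰ₀ + 2 #(r-edges of gen)` gives `#𝒟 ≤ 2 #(gen 𝒟 x)`.  Taking `ℰ₀` maximal (`#𝒟 = 2 #ℰ₀ + 2 t_r`, `t_r` = half the number of
`r`-edges of `𝒟`), this is the reduction "HEX(n−1) ∧ (gen has at least half as many r-edges as 𝒟) ⟹ HEX for 𝒟" of the memo, verified to be
applicable (for some `r`) to every non-full-cube labelling of `2^[3]`, `2^[4]` and to every family without a disjoint close pair (n ≤ 6 tested).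
A small generic lemma used by the companion architecture file is included: a fixed-point-free involution on a finite set has a half
(`exists_half_of_involution`, `card_eq_two_mul_card_half`).
-/

namespace Summit.CriticalPhenomena.PercolationContinuityZ3.Theorems

namespace GeneratedDonors

open Finset

variable {α : Type*} [DecidableEq α]

/-- **HEX-MS relative to a ground set `U`**: if every member of `𝒟` lies in `U`, `𝒟` is closed under `U \ ·` and `x` is antipodal on `𝒟`,
then `#𝒟 ≤ 2 · #(gen 𝒟 x)`.  For `U = univ` this is `HexMSAt`. -/
def HexMSRel (U : Finset α) (𝒟 : Finset (Finset α)) (x : Finset α → ZMod 6) : Prop :=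
  (∀ a ∈ 𝒟, a ⊆ U) → (∀ a ∈ 𝒟, U \ a ∈ 𝒟) → (∀ a ∈ 𝒟, x (U \ a) = x a + 3) → #𝒟 ≤ 2 * #(gen 𝒟 x)

/-- The relative form at `U = univ` is the g64 statement `HexMSAt`. -/
theorem hexMSRel_univ_iff {α : Type*} [Fintype α] [DecidableEq α] (𝒟 : Finset (Finset α)) (x : Finset α → ZMod 6) :
    HexMSRel univ 𝒟 x ↔ HexMSAt 𝒟 x := by
  unfold HexMSRel HexMSAt
  constructor
  · intro h hco hanti
    exact h (fun a _ => subset_univ a) hco hanti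
  · intro h _ hco hanti
    exact h hco hanti

section Counting

/-- The `r`-edges of a set family `G` (in the hypercube graph): members `p` with `r ∉ p` and `insert r p ∈ G`. -/
def edgesAt (G : Finset (Finset α)) (r : α) : Finset (Finset α) :=
  G.filter fun p => r ∉ p ∧ insert r p ∈ G

/-- Membership in `edgesAt`. -/
theorem mem_edgesAt {G : Finset (Finset α)} {r : α} {p : Finset α} :
    p ∈ edgesAt G r ↔ p ∈ G ∧ r ∉ p ∧ insert r p ∈ G := by
  unfold edgesAt; rw [mem_filter]

/-- **Projection identity**: `#G = #(G.image (erase · r)) + #(edgesAt G r)` — projecting along `r` identifies exactly the two ends of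
each `r`-edge of `G`. -/
theorem card_eq_card_image_erase_add_card_edgesAt (G : Finset (Finset α)) (r : α) :
    #G = #(G.image fun p => p.erase r) + #(edgesAt G r) := by
  classical
  set G0 : Finset (Finset α) := G.filter fun p => r ∉ p with hG0
  set G1 : Finset (Finset α) := G.filter fun p => r ∈ p with hG1
  -- G = G0 ⊔ G1
  have hsplit : #G = #G0 + #G1 := by
    rw [hG0, hG1, add_comm]
    exact (card_filter_add_card_filter_not (fun p => r ∈ p)).symm
  -- image of erase = G0 ∪ G1.image erase
  have herase0 : ∀ p ∈ G0, p.erase r = p := fun p hp => by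
    rw [hG0, mem_filter] at hp; exact erase_eq_of_notMem hp.2
  have himg : G.image (fun p => p.erase r) = G0 ∪ G1.image (fun p => p.erase r) := by
    ext q
    simp only [mem_image, mem_union]
    constructor
    · rintro ⟨p, hp, rfl⟩
      by_cases hr : r ∈ p
      · exact Or.inr ⟨p, by rw [hG1, mem_filter]; exact ⟨hp, hr⟩, rfl⟩
      · left
        rw [erase_eq_of_notMem hr, hG0, mem_filter]
        exact ⟨hp, hr⟩
    · rintro (hq | ⟨p, hp, rfl⟩)
      · refine ⟨q, ?_, herase0 q hq⟩
        rw [hG0, mem_filter] at hq; exact hq.1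
      · rw [hG1, mem_filter] at hp; exact ⟨p, hp.1, rfl⟩
  -- erase is injective on G1
  have hinj : Set.InjOn (fun p : Finset α => p.erase r) (G1 : Set (Finset α)) := by
    intro p hp q hq hpq
    rw [mem_coe, hG1, mem_filter] at hp hq
    have := congrArg (insert r) hpq
    simp only [insert_erase hp.2, insert_erase hq.2] at this
    exact this
  have hcard1 : #(G1.image fun p => p.erase r) = #G1 := card_image_of_injOn hinj
  -- the intersection G0 ∩ G1.image erase is edgesAt
  have hinter : G0 ∩ G1.image (fun p => p.erase r) = edgesAt G r := by
    ext q
    rw [mem_inter, mem_edgesAt, hG0, mem_filter, mem_image]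
    constructor
    · rintro ⟨⟨hqG, hrq⟩, p, hp, hpq⟩
      rw [hG1, mem_filter] at hp
      refine ⟨hqG, hrq, ?_⟩
      rw [← hpq, insert_erase hp.2]; exact hp.1
    · rintro ⟨hqG, hrq, hins⟩
      refine ⟨⟨hqG, hrq⟩, insert r q, ?_, ?_⟩
      · rw [hG1, mem_filter]; exact ⟨hins, mem_insert_self r q⟩
      · exact erase_insert hrq
  have hunion := card_union_add_card_inter G0 (G1.image fun p => p.erase r)
  rw [← himg, hinter, hcard1] at hunion
  omega

end Counting

section Reduction

/-- Closeness is symmetric. -/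
theorem close_comm (s t : ZMod 6) : Close s t ↔ Close t s := by
  revert s t; decide

/-- Closeness is invariant under the antipodal shift of both labels. -/
theorem close_add_three_iff (s t : ZMod 6) : Close (s + 3) (t + 3) ↔ Close s t := by
  revert s t; decide

variable (U : Finset α) (r : α) (𝒟 ℰ₀ : Finset (Finset α)) (x : Finset α → ZMod 6)

/-- The reduced family on the ground set `U.erase r`: the chosen `r`-free members `ℰ₀` and their complements inside `U.erase r`. -/
def reducedFamily : Finset (Finset α) :=
  ℰ₀ ∪ ℰ₀.image fun e => (U.erase r) \ e

/-- The reduced labelling: `x` on `ℰ₀`, and `x e + 3` on the new complement `(U.erase r) \ e`. -/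
def reducedLabel : Finset α → ZMod 6 :=
  fun s => if s ∈ ℰ₀ then x s else x ((U.erase r) \ s) + 3

variable {U r 𝒟 ℰ₀ x}

/-- Hypotheses on the chosen subfamily `ℰ₀`: members of `𝒟`, `r`-free, and no two complementary inside `U.erase r`. -/
structure ReductionData (U : Finset α) (r : α) (𝒟 ℰ₀ : Finset (Finset α)) : Prop where
  /-- the chosen sets are members of `𝒟` -/
  sub : ℰ₀ ⊆ 𝒟
  /-- the chosen sets avoid the coordinate `r` -/
  rfree : ∀ e ∈ ℰ₀, r ∉ e
  /-- no two chosen sets are complementary inside `U.erase r` -/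
  free : ∀ e ∈ ℰ₀, (U.erase r) \ e ∉ ℰ₀

/-- Members of `ℰ₀` lie in `U.erase r`. -/
theorem ReductionData.subset_erase (h : ReductionData U r 𝒟 ℰ₀) (hU : ∀ a ∈ 𝒟, a ⊆ U) {e : Finset α} (he : e ∈ ℰ₀) :
    e ⊆ U.erase r := by
  intro i hi
  rw [mem_erase]
  exact ⟨fun hir => h.rfree e he (hir ▸ hi), hU e (h.sub he) hi⟩

/-- Membership in the reduced family. -/
theorem mem_reducedFamily {s : Finset α} :
    s ∈ reducedFamily U r ℰ₀ ↔ s ∈ ℰ₀ ∨ ∃ e ∈ ℰ₀, (U.erase r) \ e = s := by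
  unfold reducedFamily; rw [mem_union, mem_image]

/-- The reduced family lives on `U.erase r`. -/
theorem reducedFamily_subset (h : ReductionData U r 𝒟 ℰ₀) (hU : ∀ a ∈ 𝒟, a ⊆ U) :
    ∀ s ∈ reducedFamily U r ℰ₀, s ⊆ U.erase r := by
  intro s hs
  rcases mem_reducedFamily.mp hs with hs | ⟨e, _, rfl⟩
  · exact h.subset_erase hU hs
  · exact sdiff_subset

/-- The reduced family is closed under complementation inside `U.erase r`. -/
theorem reducedFamily_compl (h : ReductionData U r 𝒟 ℰ₀) (hU : ∀ a ∈ 𝒟, a ⊆ U) :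
    ∀ s ∈ reducedFamily U r ℰ₀, (U.erase r) \ s ∈ reducedFamily U r ℰ₀ := by
  intro s hs
  rcases mem_reducedFamily.mp hs with hs | ⟨e, he, rfl⟩
  · exact mem_reducedFamily.mpr (Or.inr ⟨s, hs, rfl⟩)
  · rw [Finset.sdiff_sdiff_eq_self (h.subset_erase hU he)]
    exact mem_reducedFamily.mpr (Or.inl he)

/-- The reduced label of a member of `ℰ₀`. -/
theorem reducedLabel_of_mem {e : Finset α} (he : e ∈ ℰ₀) : reducedLabel U r ℰ₀ x e = x e := by
  unfold reducedLabel; rw [if_pos he]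

/-- The reduced label of a new complement. -/
theorem reducedLabel_of_compl (h : ReductionData U r 𝒟 ℰ₀) (hU : ∀ a ∈ 𝒟, a ⊆ U) {e : Finset α} (he : e ∈ ℰ₀) :
    reducedLabel U r ℰ₀ x ((U.erase r) \ e) = x e + 3 := by
  unfold reducedLabel
  rw [if_neg (h.free e he), Finset.sdiff_sdiff_eq_self (h.subset_erase hU he)]

/-- The reduced labelling is antipodal on the reduced family. -/
theorem reducedLabel_anti (h : ReductionData U r 𝒟 ℰ₀) (hU : ∀ a ∈ 𝒟, a ⊆ U) :
    ∀ s ∈ reducedFamily U r ℰ₀,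
      reducedLabel U r ℰ₀ x ((U.erase r) \ s) = reducedLabel U r ℰ₀ x s + 3 := by
  intro s hs
  rcases mem_reducedFamily.mp hs with hs | ⟨e, he, rfl⟩
  · rw [reducedLabel_of_compl h hU hs, reducedLabel_of_mem hs]
  · rw [Finset.sdiff_sdiff_eq_self (h.subset_erase hU he), reducedLabel_of_mem he, reducedLabel_of_compl h hU he]
    have : ∀ s : ZMod 6, s = s + 3 + 3 := by decide
    exact this (x e)

/-- For `e ⊆ U.erase r`: removing the complement of `f` inside `U.erase r` from `e` leaves `e ∩ f`. -/
theorem sdiff_compl_erase_eq_inter {e f : Finset α} (he : e ⊆ U.erase r) :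
    e \ ((U.erase r) \ f) = e ∩ f := by
  ext i
  simp only [mem_sdiff, mem_inter, not_and, not_not]
  constructor
  · rintro ⟨hie, h2⟩; exact ⟨hie, h2 (he hie)⟩
  · rintro ⟨hie, hif⟩; exact ⟨hie, fun _ => hif⟩

/-- For `e ⊆ U`: removing the complement of `f` inside `U` from `e` leaves `e ∩ f`. -/
theorem sdiff_univ_compl_eq_inter {e f : Finset α} (he : e ⊆ U) :
    e \ (U \ f) = e ∩ f := by
  ext i
  simp only [mem_sdiff, mem_inter, not_and, not_not]
  constructor
  · rintro ⟨hie, h2⟩; exact ⟨hie, h2 (he hie)⟩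
  · rintro ⟨hie, hif⟩; exact ⟨hie, fun _ => hif⟩

/-- **The generated family of the reduced instance projects into that of `𝒟`**: every product of the reduced instance is `p.erase r`
for a product `p` of `𝒟`. -/
theorem gen_reduced_subset (h : ReductionData U r 𝒟 ℰ₀) (hU : ∀ a ∈ 𝒟, a ⊆ U) (hco : ∀ a ∈ 𝒟, U \ a ∈ 𝒟)
    (hanti : ∀ a ∈ 𝒟, x (U \ a) = x a + 3) :
    gen (reducedFamily U r ℰ₀) (reducedLabel U r ℰ₀ x) ⊆ (gen 𝒟 x).image fun p => p.erase r := by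
  intro q hq
  obtain ⟨a, ha, b, hb, hcl, rfl⟩ := mem_gen.mp hq
  rw [mem_image]
  -- r-free products of 𝒟 are their own projections
  have proj_of_rfree : ∀ p ∈ gen 𝒟 x, r ∉ p → p ∈ (gen 𝒟 x) ∧ p.erase r = p := fun p hp hr =>
    ⟨hp, erase_eq_of_notMem hr⟩
  rcases mem_reducedFamily.mp ha with hae | ⟨e, he, rfl⟩ <;>
    rcases mem_reducedFamily.mp hb with hbf | ⟨f, hf, rfl⟩
  · -- a = e, b = f, both in ℰ₀: product e \ f, r-free, in gen 𝒟 x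
    rw [reducedLabel_of_mem hae, reducedLabel_of_mem hbf] at hcl
    refine ⟨a \ b, mem_gen.mpr ⟨a, h.sub hae, b, h.sub hbf, hcl, rfl⟩, ?_⟩
    exact erase_eq_of_notMem fun hr => h.rfree a hae (mem_sdiff.mp hr).1
  · -- a = e ∈ ℰ₀, b = (U.erase r) \ f: product e ∩ f = e \ (U \ f), pair (e, U \ f) close
    rw [reducedLabel_of_mem hae, reducedLabel_of_compl h hU hf] at hcl
    have hp : a \ (U \ f) ∈ gen 𝒟 x :=
      mem_gen.mpr ⟨a, h.sub hae, U \ f, hco f (h.sub hf), by rw [hanti f (h.sub hf)]; exact hcl, rfl⟩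
    refine ⟨a \ (U \ f), hp, ?_⟩
    rw [sdiff_univ_compl_eq_inter (hU a (h.sub hae)), sdiff_compl_erase_eq_inter (h.subset_erase hU hae)]
    exact erase_eq_of_notMem fun hr => h.rfree a hae (mem_inter.mp hr).1
  · -- a = (U.erase r) \ e, b = f ∈ ℰ₀: product (U.erase r) \ (e ∪ f) = erase r ((U \ e) \ f); pair (U \ e, f) close
    rw [reducedLabel_of_compl h hU he, reducedLabel_of_mem hbf] at hcl
    have hp : (U \ e) \ b ∈ gen 𝒟 x :=
      mem_gen.mpr ⟨U \ e, hco e (h.sub he), b, h.sub hbf, by rw [hanti e (h.sub he)]; exact hcl, rfl⟩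
    refine ⟨(U \ e) \ b, hp, ?_⟩
    ext i
    simp only [mem_erase, mem_sdiff]
    tauto
  · -- a = (U.erase r) \ e, b = (U.erase r) \ f: product = f \ e, pair (f, e) close
    rw [reducedLabel_of_compl h hU he, reducedLabel_of_compl h hU hf, close_add_three_iff] at hcl
    have hcl' : Close (x f) (x e) := (close_comm _ _).mp hcl
    have hp : f \ e ∈ gen 𝒟 x := mem_gen.mpr ⟨f, h.sub hf, e, h.sub he, hcl', rfl⟩
    refine ⟨f \ e, hp, ?_⟩
    have hfe : ((U.erase r) \ e) \ ((U.erase r) \ f) = f \ e := by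
      ext i
      simp only [mem_sdiff, mem_erase]
      constructor
      · rintro ⟨⟨hiU, hie⟩, h2⟩
        refine ⟨?_, hie⟩
        by_contra hif
        exact h2 ⟨hiU, hif⟩
      · rintro ⟨hif, hie⟩
        have hiU : i ≠ r ∧ i ∈ U := mem_erase.mp (h.subset_erase hU hf hif)
        exact ⟨⟨hiU, hie⟩, fun h2 => h2.2 hif⟩
    rw [hfe]
    exact erase_eq_of_notMem fun hr => h.rfree f hf (mem_sdiff.mp hr).1

/-- Cardinality of the reduced family: `2 · #ℰ₀`. -/
theorem card_reducedFamily (h : ReductionData U r 𝒟 ℰ₀) (hU : ∀ a ∈ 𝒟, a ⊆ U) :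
    #(reducedFamily U r ℰ₀) = 2 * #ℰ₀ := by
  unfold reducedFamily
  have hdisj : Disjoint ℰ₀ (ℰ₀.image fun e => (U.erase r) \ e) := by
    rw [disjoint_left]
    intro s hs hs'
    obtain ⟨e, he, rfl⟩ := mem_image.mp hs'
    exact h.free e he hs
  have hinj : Set.InjOn (fun e : Finset α => (U.erase r) \ e) (ℰ₀ : Set (Finset α)) := by
    intro e he f hf hef
    have := congrArg (fun s => (U.erase r) \ s) hef
    simp only [Finset.sdiff_sdiff_eq_self (h.subset_erase hU (mem_coe.mp he)),
      Finset.sdiff_sdiff_eq_self (h.subset_erase hU (mem_coe.mp hf))] at this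
    exact this
  rw [card_union_of_disjoint hdisj, card_image_of_injOn hinj]
  ring

/-- **Coordinate reduction for HEX-MS** (memo §0(1)).  Let `𝒟` be an antipodal instance on the ground set `U`, `r ∈ U`... (only used
through the hypotheses), and `ℰ₀` a set of `r`-free members with no two complementary inside `U.erase r`.  If HEX-MS holds for the reduced
instance on `U.erase r` and `#𝒟 ≤ 2 #ℰ₀ + 2 · #(r-edges of gen 𝒟 x)` (i.e. the generated family has at least as many `r`-edges as there are
antipodal pairs of `𝒟` not represented in `ℰ₀`), then `#𝒟 ≤ 2 · #(gen 𝒟 x)`. -/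
theorem card_le_two_mul_card_gen_of_reduction (h : ReductionData U r 𝒟 ℰ₀) (hU : ∀ a ∈ 𝒟, a ⊆ U)
    (hco : ∀ a ∈ 𝒟, U \ a ∈ 𝒟) (hanti : ∀ a ∈ 𝒟, x (U \ a) = x a + 3)
    (hIH : HexMSRel (U.erase r) (reducedFamily U r ℰ₀) (reducedLabel U r ℰ₀ x))
    (hedges : #𝒟 ≤ 2 * #ℰ₀ + 2 * #(edgesAt (gen 𝒟 x) r)) :
    #𝒟 ≤ 2 * #(gen 𝒟 x) := by
  have h1 : #(reducedFamily U r ℰ₀) ≤ 2 * #(gen (reducedFamily U r ℰ₀) (reducedLabel U r ℰ₀ x)) :=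
    hIH (reducedFamily_subset h hU) (reducedFamily_compl h hU) (reducedLabel_anti h hU)
  rw [card_reducedFamily h hU] at h1
  have h2 : #(gen (reducedFamily U r ℰ₀) (reducedLabel U r ℰ₀ x)) ≤ #((gen 𝒟 x).image fun p => p.erase r) :=
    card_le_card (gen_reduced_subset h hU hco hanti)
  have h3 := card_eq_card_image_erase_add_card_edgesAt (gen 𝒟 x) r
  omega

end Reduction

section Halves

variable {β : Type*} [DecidableEq β]

/-- A fixed-point-free involution on a finite set admits a HALF: a subset meeting every orbit `{s, σ s}` in exactly one point. -/
theorem exists_half_of_involution (σ : β → β) :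
    ∀ (S : Finset β), (∀ s ∈ S, σ s ∈ S) → (∀ s ∈ S, σ (σ s) = s) → (∀ s ∈ S, σ s ≠ s) →
      ∃ H ⊆ S, (∀ h ∈ H, σ h ∉ H) ∧ (∀ s ∈ S, s ∈ H ∨ σ s ∈ H) := by
  intro S
  induction S using Finset.strongInduction with
  | H S ih =>
    intro hcl hinv hfix
    by_cases hS : S = ∅
    · exact ⟨∅, empty_subset _, fun h hh => (notMem_empty h hh).elim, fun s hs => by rw [hS] at hs; exact (notMem_empty s hs).elim⟩
    · obtain ⟨s0, hs0⟩ := nonempty_iff_ne_empty.mpr hS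
      set S' : Finset β := (S.erase s0).erase (σ s0) with hS'
      have hS'sub : S' ⊆ S := fun t ht => by
        rw [hS', mem_erase, mem_erase] at ht; exact ht.2.2
      have hS'ss : S' ⊂ S := by
        refine ⟨hS'sub, fun h => ?_⟩
        have : s0 ∈ S' := h hs0
        rw [hS', mem_erase, mem_erase] at this
        exact this.2.1 rfl
      have hmemS' : ∀ t, t ∈ S' ↔ t ∈ S ∧ t ≠ s0 ∧ t ≠ σ s0 := fun t => by
        rw [hS', mem_erase, mem_erase]; tauto
      have hcl' : ∀ t ∈ S', σ t ∈ S' := by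
        intro t ht
        rw [hmemS'] at ht ⊢
        refine ⟨hcl t ht.1, fun h => ht.2.2 ?_, fun h => ht.2.1 ?_⟩
        · rw [← h, hinv t ht.1]
        · have := congrArg σ h
          rwa [hinv t ht.1, hinv s0 hs0] at this
      obtain ⟨H', hH'sub, hH'free, hH'cov⟩ :=
        ih S' hS'ss hcl' (fun t ht => hinv t (hS'sub ht)) (fun t ht => hfix t (hS'sub ht))
      refine ⟨insert s0 H', ?_, ?_, ?_⟩
      · exact insert_subset hs0 (hH'sub.trans hS'sub)
      · intro h hh
        rw [mem_insert] at hh ⊢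
        rintro (h1 | h1)
        · rcases hh with rfl | hh
          · exact hfix h hs0 h1
          · have := (hmemS' h).mp (hH'sub hh)
            exact this.2.2 (by rw [← h1, hinv h this.1])
        · rcases hh with rfl | hh
          · have := (hmemS' _).mp (hH'sub h1)
            exact this.2.2 rfl
          · exact hH'free h hh h1
      · intro t ht
        by_cases h1 : t = s0
        · exact Or.inl (mem_insert.mpr (Or.inl h1))
        by_cases h2 : t = σ s0
        · right; rw [h2, hinv s0 hs0]; exact mem_insert_self _ _
        rcases hH'cov t ((hmemS' t).mpr ⟨ht, h1, h2⟩) with h | h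
        · exact Or.inl (mem_insert_of_mem h)
        · exact Or.inr (mem_insert_of_mem h)

/-- The cardinality of a set with a fixed-point-free involution is twice that of a half. -/
theorem card_eq_two_mul_card_half (σ : β → β) (S H : Finset β) (hcl : ∀ s ∈ S, σ s ∈ S)
    (hinv : ∀ s ∈ S, σ (σ s) = s) (hHS : H ⊆ S) (hfree : ∀ h ∈ H, σ h ∉ H)
    (hcov : ∀ s ∈ S, s ∈ H ∨ σ s ∈ H) : #S = 2 * #H := by
  have hunion : S = H ∪ H.image σ := by
    ext t
    rw [mem_union, mem_image]
    constructor
    · intro ht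
      rcases hcov t ht with h | h
      · exact Or.inl h
      · exact Or.inr ⟨σ t, h, hinv t ht⟩
    · rintro (h | ⟨u, hu, rfl⟩)
      · exact hHS h
      · exact hcl u (hHS hu)
  have hdisj : Disjoint H (H.image σ) := by
    rw [disjoint_left]
    rintro t ht ht'
    obtain ⟨u, hu, rfl⟩ := mem_image.mp ht'
    exact hfree u hu ht
  have hinj : Set.InjOn σ (H : Set β) := by
    intro u hu v hv huv
    have := congrArg σ huv
    rwa [hinv u (hHS (mem_coe.mp hu)), hinv v (hHS (mem_coe.mp hv))] at this
  rw [hunion, card_union_of_disjoint hdisj, card_image_of_injOn hinj]; ring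

end Halves

end GeneratedDonors

end Summit.CriticalPhenomena.PercolationContinuityZ3.Theorems
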